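import Summits.Ventures.CertifiedManyBodySolver.Downfold.EmeryShapeTrueCornerBand
import Summits.Ventures.CertifiedManyBodySolver.Downfold.EmeryFermiScalePointsTl2223OPK15TrueCorners
import Summits.Ventures.CertifiedManyBodySolver.Downfold.EmeryFermiScalePointsTl2223OPK15VirtualCorners
import HarnessLib

/-!
# THE ONE-BAND FERMI-SURFACE SHAPE `t′/t` OF THE WHOLE TYPED 3BE BOX `emeryBoxTl2223OPK15Src (EmeryBoxesKSlicesS)` OVER ITS WHOLE FILLING BAND, AT ITS TWO TRUE CORNERS (true-corner rule, band form,
# §B.87 (j); router/EMERY-SHAPE-CORNERS.tsv «true band» rows)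

Venture CertifiedManyBodySolver, cell `pub/hubbard-downfold` (stage S1; INFLATION-RULES-3to1-B §B.87 (j)), seat hubbard-downfold-mod-4 (technique B, g35); namespace
`Summit.Ventures.CertifiedManyBodySolver.Downfold.Emery`. Everything PROVED (0 sorry; no new certificate — the end-filling brackets of the per-filling files are re-read).
WHAT THIS IS NOT: a statement about Tl₂Ba₂Ca₂Cu₃O₁₀ OUTER plane ((K) source box) — the typed box is SCREENING-GRADE; `U = 0` one-body kinematics of the σ model (rigid band).

For EVERY one-body row of `[1.62, 2.39] × [1.18, 1.39] × [0.61, 0.72] × [0.15, 0.18]` eV AND EVERY filling `ν ∈ [41/100, 43/100]` the one-band `t′/t` lies in **[-0.3244, -0.2534]**: the true-corner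
squeeze `fsRatio_fermiEnergyOf_trueCorner_lower_band` / `…_upper_band` (`EmeryShapeTrueCornerBand`: slab windows `[pL, qL] = [15341/10000, 16477/10000]`, `[pU, qU] = [16613/10000, 17633/10000]`, regime `qT = 4053/2000`
certified at the END fillings; margin constants lower slab M_b 0.4979 / M_c 0.0615, upper slab M_b 2.2997 / M_c 0.0), read at the true corners over their band windows
`[977/625, 16213/10000]` (lipschitz) and `[3373/2000, 17323/10000]` (monotone) (`fermiEnergyOf_mem_Icc_of_band`). Comparator (certified, g19 sub-box device, n_H band): [-0.3265,-0.2512] (n_H band).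

Sources: three-band model [HybertsenSchluterChristensen1989, Eq. (1)]; [AndersenEtAl1995, §6]; box rows as cited in the typed object's file.
-/

noncomputable section

namespace Summit.Ventures.CertifiedManyBodySolver.Downfold.Emery

open Real Set

/-- **filling band ν ∈ [41/100, 43/100] (n_H = 1.18 (ν = 41/100) … n_H = 1.14 (ν = 43/100)): for every row of the box AND every filling of the band the one-band Fermi-surface `t′/t` (object E) lies in `[-0.3244, -0.2534]` — between its values at the two TRUE corners** (band form of the true-corner rule; margins by `norm_num`). [folklore] -/
theorem tl2223OPK15Box_fsRatio_true_band {Δ a b c ν : ℝ} (hΔ : Δ ∈ Icc ((81 : ℝ) / 50) ((239 : ℝ) / 100)) (ha : a ∈ Icc ((59 : ℝ) / 50) ((139 : ℝ) / 100)) (hb : b ∈ Icc ((61 : ℝ) / 100) ((18 : ℝ) / 25)) (hc : c ∈ Icc ((3 : ℝ) / 20) ((9 : ℝ) / 50)) (hν : ν ∈ Icc ((41 : ℝ) / 100) ((43 : ℝ) / 100)) :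
    fsRatio Δ a b c (fermiEnergyOf Δ a b c ν) ∈ Icc ((-811 : ℝ) / 2500) ((-1267 : ℝ) / 5000) := by
  have hSL := (fermiEnergyOf_of_pointBracketCheck truePt_Tl2223OPK15SL_nH118_br (by norm_num) (by norm_num) (by norm_num) (ν := (41/100 : ℝ)) (by push_cast; exact ⟨le_rfl, le_rfl⟩)).2
  have hAlo := (fermiEnergyOf_of_pointBracketCheck virtPt_Tl2223OPK15Alo_nH114_br (by norm_num) (by norm_num) (by norm_num) (ν := (43/100 : ℝ)) (by push_cast; exact ⟨le_rfl, le_rfl⟩)).2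
  have hTop := (fermiEnergyOf_of_pointBracketCheck virtPt_Tl2223OPK15H_nH114_br (by norm_num) (by norm_num) (by norm_num) (ν := (43/100 : ℝ)) (by push_cast; exact ⟨le_rfl, le_rfl⟩)).2
  have hSU := (fermiEnergyOf_of_pointBracketCheck truePt_Tl2223OPK15SU_nH118_br (by norm_num) (by norm_num) (by norm_num) (ν := (41/100 : ℝ)) (by push_cast; exact ⟨le_rfl, le_rfl⟩)).2
  have hQU := (fermiEnergyOf_of_pointBracketCheck truePt_Tl2223OPK15QU_nH114_br (by norm_num) (by norm_num) (by norm_num) (ν := (43/100 : ℝ)) (by push_cast; exact ⟨le_rfl, le_rfl⟩)).2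
  have hTL1 := (fermiEnergyOf_of_pointBracketCheck truePt_Tl2223OPK15TL_nH118_br (by norm_num) (by norm_num) (by norm_num) (ν := (41/100 : ℝ)) (by push_cast; exact ⟨le_rfl, le_rfl⟩)).2
  have hTL2 := (fermiEnergyOf_of_pointBracketCheck truePt_Tl2223OPK15TL_nH114_br (by norm_num) (by norm_num) (by norm_num) (ν := (43/100 : ℝ)) (by push_cast; exact ⟨le_rfl, le_rfl⟩)).2
  have hTH1 := (fermiEnergyOf_of_pointBracketCheck truePt_Tl2223OPK15TH_nH118_br (by norm_num) (by norm_num) (by norm_num) (ν := (41/100 : ℝ)) (by push_cast; exact ⟨le_rfl, le_rfl⟩)).2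
  have hTH2 := (fermiEnergyOf_of_pointBracketCheck truePt_Tl2223OPK15TH_nH114_br (by norm_num) (by norm_num) (by norm_num) (ν := (43/100 : ℝ)) (by push_cast; exact ⟨le_rfl, le_rfl⟩)).2
  push_cast at hSL hAlo hTop hSU hQU hTL1 hTL2 hTH1 hTH2
  norm_num at hSL hAlo hTop hSU hQU hTL1 hTL2 hTH1 hTH2
  obtain ⟨hΔl, hΔu⟩ := hΔ
  obtain ⟨hal, hau⟩ := ha
  have hTL := fermiEnergyOf_mem_Icc_of_band (Δ := ((81 : ℝ) / 50)) (a := ((59 : ℝ) / 50)) (b := ((18 : ℝ) / 25)) (c := ((9 : ℝ) / 50)) (e₁ := ((977 : ℝ) / 625)) (e₂ := ((16213 : ℝ) / 10000)) (by norm_num) (by norm_num) (by norm_num) (by norm_num) (by norm_num) hν (by norm_num) hTL1.1 hTL2.2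
  have hTH := fermiEnergyOf_mem_Icc_of_band (Δ := ((239 : ℝ) / 100)) (a := ((139 : ℝ) / 100)) (b := ((61 : ℝ) / 100)) (c := ((3 : ℝ) / 20)) (e₁ := ((3373 : ℝ) / 2000)) (e₂ := ((17323 : ℝ) / 10000)) (by norm_num) (by norm_num) (by norm_num) (by norm_num) (by norm_num) hν (by norm_num) hTH1.1 hTH2.2
  constructor
  · have hlow := fsRatio_fermiEnergyOf_trueCorner_lower_band (Δ₁ := ((81 : ℝ) / 50)) (a₁ := ((59 : ℝ) / 50)) (b₁ := ((61 : ℝ) / 100)) (b₂ := ((18 : ℝ) / 25)) (c₁ := ((3 : ℝ) / 20)) (c₂ := ((9 : ℝ) / 50)) (ν₁ := ((41 : ℝ) / 100)) (ν₂ := ((43 : ℝ) / 100))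
      (pL := ((15341 : ℝ) / 10000)) (qL := ((16477 : ℝ) / 10000)) (Mb := ((4979 : ℝ) / 10000)) (Mc := ((123 : ℝ) / 2000)) (by norm_num) hΔl (by norm_num) hal (by norm_num) hb (by norm_num) hc (by norm_num) (by norm_num) hν (by norm_num)
      (by norm_num) hSL.1 hAlo.2 (by norm_num) (by norm_num [fsD, fsN]) (by norm_num) (by norm_num) (by norm_num [fsD, fsN]) (by norm_num) (by norm_num [dopingDisc]) (by norm_num [fsD, fsN])
    refine le_trans ?_ hlow
    have hw := fsRatio_ge_on_window (Δ := ((81 : ℝ) / 50)) (a := ((59 : ℝ) / 50)) (b := ((18 : ℝ) / 25)) (c := ((9 : ℝ) / 50)) (p := ((977 : ℝ) / 625)) (q := ((16213 : ℝ) / 10000))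
      (M := ((193 : ℝ) / 5000)) (by norm_num) (by norm_num) (by norm_num) (by norm_num) (by norm_num [fsD, fsN]) (by norm_num [dopingDisc]) (by norm_num [dopingDisc]) hTL
    refine le_trans ?_ hw
    norm_num [fsRatio, fsD, fsN]
  · have hup := fsRatio_fermiEnergyOf_trueCorner_upper_band (Δ₁ := ((81 : ℝ) / 50)) (Δ₂ := ((239 : ℝ) / 100)) (a₁ := ((59 : ℝ) / 50)) (a₂ := ((139 : ℝ) / 100)) (b₁ := ((61 : ℝ) / 100)) (b₂ := ((18 : ℝ) / 25)) (c₁ := ((3 : ℝ) / 20)) (c₂ := ((9 : ℝ) / 50)) (ν₁ := ((41 : ℝ) / 100)) (ν₂ := ((43 : ℝ) / 100))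
      (pU := ((16613 : ℝ) / 10000)) (qU := ((17633 : ℝ) / 10000)) (qT := ((4053 : ℝ) / 2000)) (Mb := ((22997 : ℝ) / 10000)) (Mc := (0 : ℝ)) (by norm_num) ⟨hΔl, hΔu⟩ (by norm_num) ⟨hal, hau⟩ (by norm_num) hb (by norm_num) hc (by norm_num) (by norm_num) hν (by norm_num)
      hTop.2 (by norm_num) (by norm_num) hSU.1 hQU.2 (by norm_num) (by norm_num [fsD, fsN]) (by norm_num) (by norm_num) (by norm_num [fsD, fsN]) (by norm_num) (by norm_num) (by norm_num [fsD, fsN])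
    refine le_trans hup ?_
    have hw := (fsRatio_mem_Icc_on_window_of_dopingDisc_nonpos (Δ := ((239 : ℝ) / 100)) (a := ((139 : ℝ) / 100)) (b := ((61 : ℝ) / 100)) (c := ((3 : ℝ) / 20))
      (p := ((3373 : ℝ) / 2000)) (q := ((17323 : ℝ) / 10000)) (by norm_num) (by norm_num) (by norm_num) (by norm_num) (by norm_num) (by norm_num) (by norm_num) (by norm_num [dopingDisc]) hTH).2
    refine le_trans hw ?_
    norm_num [fsRatio, fsD, fsN]

end Summit.Ventures.CertifiedManyBodySolver.Downfold.Emery
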